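import Literature.Computability.Complexity.FourierDegree
import HarnessLib

/-!
# Crux `MobiusLadder.LiouvilleOrthogonalTC0` (stmt-QuantumAdvantage-1393), line `Sketch`,
# skeleton v10 (PTF rung): stub `stub_drstAS` (Diakonikolas–Raghavendra–Servedio–Tan,
# Theorem 1.2, counting form)

For a real function `q` on the cube `Fin m → Bool` write
`piv(q) = Σ_ω #{i : [0 ≤ q ω] ≠ [0 ≤ q ω^{(i)}]}` (`ω^{(i)}` = `ω` with bit `i` flipped), i.e.
`2^m` times the average sensitivity of the polynomial threshold function `[q ≥ 0]`, and
`D_j q (ω) = sgn(ω j) · (q ω − q ω^{(j)})` for the discrete derivative in direction `j`.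

**Theorem** (`stub_drstAS`). Assume the recursion
`piv(q)² ≤ 2^m (m 2^m + Σ_j piv(D_j q))` for every `m` and every real `q` (hypothesis `hRec`,
the neighbouring stub `stub_drstRecursion`; I. Diakonikolas, P. Raghavendra, R. A. Servedio,
L.-Y. Tan, *Average sensitivity and noise sensitivity of polynomial threshold functions*,
SIAM J. Comput. 43 (2014) = arXiv:0909.5011, §6). Then every `q` of Fourier–Walsh degree `≤ d`
has `piv(q) ≤ 2 m^{1 − 1/2^d} 2^m` (loc. cit., Theorem 1.2).

## Proof

Induction on `d` (for `m ≥ 1`; for `m = 0` there are no coordinates and `piv = 0`).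
* `d = 0`: a function of degree `0` is constant (`one_le_fourierDegree`), so no bit is pivotal
  and `piv(q) = 0` (`StubDrstAS.sum_card_pivotal_eq_zero`).
* `d + 1`: the Fourier–Walsh coefficients of the derivative are `(D_j q)^(U) = 0` if `j ∈ U` and
  `= 2 q̂(U ∪ {j})` if `j ∉ U` (`StubDrstAS.cubeFourierCoeff_deriv`: the bit flip `ω ↦ ω^{(j)}`
  is an involution of the cube and multiplies the character `χ_S` by `−1` exactly when `j ∈ S`),
  hence `deg(D_j q) ≤ d` (`StubDrstAS.fourierDegree_deriv_le`) and the induction hypothesis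
  gives `Σ_j piv(D_j q) ≤ m · 2 m^{1−1/2^d} 2^m`. With the recursion,
  `piv(q)² ≤ 4^m (m + 2 m^{2−1/2^d}) ≤ 4^m · 4 m^{2−1/2^d} = (2 m^{1−1/2^{d+1}} 2^m)²`
  because `m ≤ m^{2 − 1/2^d}` for `m ≥ 1` (`StubDrstAS.arith`).
-/

set_option linter.dupNamespace false -- D-0017: single-problem summit ⇒ QuantumAdvantage.QuantumAdvantage by design

noncomputable section

namespace Summit.QuantumAdvantage.QuantumAdvantage.Theorems.LiouvilleOrthogonalTC0

open Finset
open Literature.Computability.Complexity Literature.Computability.Complexity.LowDegree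
open Literature.Probability.RandomGraphs.LowDegree (sgn walsh)

namespace StubDrstAS

variable {m : ℕ}

/-- A constant function has no pivotal bits: `piv(q) = 0`. -/
theorem sum_card_pivotal_eq_zero {q : (Fin m → Bool) → ℝ} (h : ∀ ω ω', q ω = q ω') :
    ∑ ω : Fin m → Bool, ((Finset.univ.filter fun i : Fin m =>
        decide (0 ≤ q ω) ≠ decide (0 ≤ q (Function.update ω i (!ω i)))).card : ℝ) = 0 := by
  refine Finset.sum_eq_zero fun ω _ => ?_
  rw [Nat.cast_eq_zero, Finset.card_eq_zero, Finset.filter_eq_empty_iff]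
  intro i _ hne
  exact hne (by rw [h ω (Function.update ω i (!ω i))])

/-- Flipping bit `j` twice is the identity. -/
theorem flip_flip (x : Fin m → Bool) (j : Fin m) :
    Function.update (Function.update x j (!x j)) j (!(Function.update x j (!x j) j)) = x := by
  rw [Function.update_self, Bool.not_not, Function.update_idem, Function.update_eq_self]

/-- Reindexing a sum over the cube by the bit flip `ω ↦ ω^{(j)}` (an involution). -/
theorem sum_flip (g : (Fin m → Bool) → ℝ) (j : Fin m) :
    ∑ x : Fin m → Bool, g (Function.update x j (!x j)) = ∑ x, g x :=
  Function.Bijective.sum_comp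
    (Function.Involutive.bijective
      (show Function.Involutive (fun x : Fin m → Bool => Function.update x j (!x j)) from
        fun x => flip_flip x j)) g

/-- A character at a flipped point: `χ_S(ω^{(j)}) = −χ_S(ω)` if `j ∈ S`, `= χ_S(ω)` otherwise
(O'Donnell 2014, §1.4). -/
theorem walsh_update_not (S : Finset (Fin m)) (x : Fin m → Bool) (j : Fin m) :
    walsh S (Function.update x j (!x j)) = (if j ∈ S then -1 else 1) * walsh S x := by
  unfold walsh
  by_cases h : j ∈ S
  · have hsn : sgn (!x j) = -sgn (x j) := by cases x j <;> simp
    rw [if_pos h, ← Finset.mul_prod_erase S _ h, ← Finset.mul_prod_erase S (fun i => sgn (x i)) h,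
      Function.update_self, hsn]
    have hc : ∀ i ∈ S.erase j, sgn (Function.update x j (!x j) i) = sgn (x i) := fun i hi => by
      rw [Function.update_of_ne (Finset.ne_of_mem_erase hi)]
    rw [Finset.prod_congr rfl hc]
    ring
  · rw [if_neg h, one_mul]
    refine Finset.prod_congr rfl fun i hi => ?_
    rw [Function.update_of_ne (ne_of_mem_of_not_mem hi h)]

/-- `Σ_ω q(ω^{(j)}) χ_S(ω) = ± Σ_ω q(ω) χ_S(ω)`, with sign `−` exactly when `j ∈ S`
(O'Donnell 2014, §1.4). -/
theorem sum_flip_mul_walsh (q : (Fin m → Bool) → ℝ) (j : Fin m) (S : Finset (Fin m)) :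
    ∑ x : Fin m → Bool, q (Function.update x j (!x j)) * walsh S x =
      (if j ∈ S then -1 else 1) * ∑ x : Fin m → Bool, q x * walsh S x := by
  have h := sum_flip (fun y => q y * walsh S (Function.update y j (!y j))) j
  simp only [flip_flip] at h
  rw [h, Finset.mul_sum]
  refine Finset.sum_congr rfl fun x _ => ?_
  rw [walsh_update_not]
  ring

/-- **Fourier–Walsh coefficients of the discrete derivative**
`D_j q (ω) = sgn(ω j) (q ω − q ω^{(j)})`: `(D_j q)^(U) = 0` if `j ∈ U` and
`(D_j q)^(U) = 2 q̂(U ∪ {j})` if `j ∉ U` (O'Donnell 2014, §2.2, the derivative operator;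
Diakonikolas–Raghavendra–Servedio–Tan, arXiv:0909.5011, §6). -/
theorem cubeFourierCoeff_deriv (q : (Fin m → Bool) → ℝ) (j : Fin m) (U : Finset (Fin m)) :
    cubeFourierCoeff (fun ω => sgn (ω j) * (q ω - q (Function.update ω j (!ω j)))) U =
      if j ∈ U then 0 else 2 * cubeFourierCoeff q (insert j U) := by
  unfold cubeFourierCoeff
  by_cases hU : j ∈ U
  · rw [if_pos hU]
    have key : ∀ x : Fin m → Bool,
        sgn (x j) * (q x - q (Function.update x j (!x j))) * walsh U x =
          q x * walsh (U.erase j) x - q (Function.update x j (!x j)) * walsh (U.erase j) x := by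
      intro x
      have hw : walsh U x = sgn (x j) * walsh (U.erase j) x := by
        unfold walsh
        exact (Finset.mul_prod_erase U (fun i => sgn (x i)) hU).symm
      rw [hw]
      linear_combination ((q x - q (Function.update x j (!x j))) * walsh (U.erase j) x) *
        Literature.Probability.RandomGraphs.LowDegree.sgn_mul_self (x j)
    simp_rw [key]
    rw [Finset.sum_sub_distrib, sum_flip_mul_walsh, if_neg (Finset.notMem_erase j U), one_mul,
      sub_self, zero_div]
  · rw [if_neg hU]
    have key : ∀ x : Fin m → Bool,
        sgn (x j) * (q x - q (Function.update x j (!x j))) * walsh U x =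
          q x * walsh (insert j U) x - q (Function.update x j (!x j)) * walsh (insert j U) x := by
      intro x
      have hw : walsh (insert j U) x = sgn (x j) * walsh U x := by
        unfold walsh
        exact Finset.prod_insert hU
      rw [hw]
      ring
    simp_rw [key]
    rw [Finset.sum_sub_distrib, sum_flip_mul_walsh, if_pos (Finset.mem_insert_self j U)]
    ring

/-- **The derivative lowers the degree**: `deg(q) ≤ d + 1 ⟹ deg(D_j q) ≤ d`
(O'Donnell 2014, §2.2; Diakonikolas–Raghavendra–Servedio–Tan, arXiv:0909.5011, §6). -/
theorem fourierDegree_deriv_le {q : (Fin m → Bool) → ℝ} {d : ℕ} (hq : fourierDegree q ≤ d + 1)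
    (j : Fin m) :
    fourierDegree (fun ω => sgn (ω j) * (q ω - q (Function.update ω j (!ω j)))) ≤ d := by
  classical
  refine Finset.sup_le fun U hU => ?_
  have hc :
      cubeFourierCoeff (fun ω => sgn (ω j) * (q ω - q (Function.update ω j (!ω j)))) U ≠ 0 := by
    simpa using hU
  rw [cubeFourierCoeff_deriv] at hc
  by_cases hjU : j ∈ U
  · rw [if_pos hjU] at hc
    exact absurd rfl hc
  · rw [if_neg hjU] at hc
    have hc' : cubeFourierCoeff q (insert j U) ≠ 0 := fun h0 => hc (by rw [h0, mul_zero])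
    have hcard := card_le_fourierDegree hc'
    rw [Finset.card_insert_of_notMem hjU] at hcard
    omega

/-- The real arithmetic of the induction step: from `P² ≤ 2^m (m 2^m + S)`,
`S ≤ Σ_{j < m} 2 m^{1−1/2^d} 2^m` and `m ≥ 1` conclude `P ≤ 2 m^{1−1/2^{d+1}} 2^m`
(Diakonikolas–Raghavendra–Servedio–Tan, arXiv:0909.5011, end of §6). -/
theorem arith {P S : ℝ} {m d : ℕ} (hm : (1 : ℝ) ≤ m) (hP : 0 ≤ P)
    (hR : P ^ 2 ≤ (2 : ℝ) ^ m * ((m : ℝ) * (2 : ℝ) ^ m + S))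
    (hS : S ≤ ∑ _j : Fin m, 2 * (m : ℝ) ^ ((1 : ℝ) - 1 / 2 ^ d) * (2 : ℝ) ^ m) :
    P ≤ 2 * (m : ℝ) ^ ((1 : ℝ) - 1 / 2 ^ (d + 1)) * (2 : ℝ) ^ m := by
  rw [Finset.sum_const, Finset.card_univ, Fintype.card_fin, nsmul_eq_mul] at hS
  have hM0 : (0 : ℝ) ≤ m := Nat.cast_nonneg m
  have hMpos : (0 : ℝ) < m := one_pos.trans_le hm
  have h2d : (1 : ℝ) ≤ 2 ^ d := one_le_pow₀ (by norm_num)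
  have hexp : (0 : ℝ) ≤ 1 - 1 / 2 ^ d := by
    rw [sub_nonneg, div_le_iff₀ (by positivity), one_mul]
    exact h2d
  have hX : (1 : ℝ) ≤ (m : ℝ) ^ ((1 : ℝ) - 1 / 2 ^ d) := Real.one_le_rpow hm hexp
  have hkey : ((m : ℝ) ^ ((1 : ℝ) - 1 / 2 ^ (d + 1))) ^ 2 =
      (m : ℝ) * (m : ℝ) ^ ((1 : ℝ) - 1 / 2 ^ d) := by
    rw [← Real.rpow_natCast, ← Real.rpow_mul hM0]
    have he : ((1 : ℝ) - 1 / 2 ^ (d + 1)) * ((2 : ℕ) : ℝ) = 1 + ((1 : ℝ) - 1 / 2 ^ d) := by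
      rw [pow_succ]
      push_cast
      field_simp
      ring
    rw [he, Real.rpow_add hMpos, Real.rpow_one]
  have hB : (0 : ℝ) ≤ 2 * (m : ℝ) ^ ((1 : ℝ) - 1 / 2 ^ (d + 1)) * (2 : ℝ) ^ m := by positivity
  rw [← pow_le_pow_iff_left₀ hP hB two_ne_zero]
  calc P ^ 2 ≤ (2 : ℝ) ^ m * ((m : ℝ) * (2 : ℝ) ^ m + S) := hR
    _ ≤ (2 : ℝ) ^ m * ((m : ℝ) * (2 : ℝ) ^ m +
          (m : ℝ) * (2 * (m : ℝ) ^ ((1 : ℝ) - 1 / 2 ^ d) * (2 : ℝ) ^ m)) := by gcongr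
    _ = ((2 : ℝ) ^ m) ^ 2 * (m : ℝ) * (1 + 2 * (m : ℝ) ^ ((1 : ℝ) - 1 / 2 ^ d)) := by ring
    _ ≤ ((2 : ℝ) ^ m) ^ 2 * (m : ℝ) * (4 * (m : ℝ) ^ ((1 : ℝ) - 1 / 2 ^ d)) := by
        gcongr
        linarith
    _ = (2 * (m : ℝ) ^ ((1 : ℝ) - 1 / 2 ^ (d + 1)) * (2 : ℝ) ^ m) ^ 2 := by
        rw [mul_pow, mul_pow, hkey]
        ring

end StubDrstAS

open StubDrstAS in
/-- **Stub P1b (wave 3, v10) — Diakonikolas–Raghavendra–Servedio–Tan, Theorem 1.2, in counting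
form:** every real `q` on `Fin m → Bool` of Fourier–Walsh degree `≤ d` has
`piv(q) ≤ 2 m^{1−1/2^d} 2^m` (the average sensitivity of the degree-`d` PTF `[q ≥ 0]` is at most
`2 m^{1−1/2^d}`), given the recursion `piv(q)² ≤ 2^m (m 2^m + Σ_j piv(D_j q))` (`hRec`, the
neighbouring stub `stub_drstRecursion`). Induction on `d`: `deg(D_j q) ≤ deg(q) − 1`
(`StubDrstAS.fourierDegree_deriv_le`), degree `0` = constant, and
`m + 2 m^{2−1/2^d} ≤ 4 m^{2−1/2^d}` (I. Diakonikolas, P. Raghavendra, R. A. Servedio, L.-Y. Tan,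
*Average sensitivity and noise sensitivity of polynomial threshold functions*, SIAM J. Comput. 43
(2014), arXiv:0909.5011, Theorem 1.2 and §6). -/
theorem stub_drstAS
    (hRec : ∀ (m : ℕ) (q : (Fin m → Bool) → ℝ),
      (∑ ω : Fin m → Bool, ((Finset.univ.filter fun i : Fin m =>
          decide (0 ≤ q ω) ≠ decide (0 ≤ q (Function.update ω i (!ω i)))).card : ℝ)) ^ 2
        ≤ (2 : ℝ) ^ m * ((m : ℝ) * (2 : ℝ) ^ m +
            ∑ j : Fin m, ∑ ω : Fin m → Bool, ((Finset.univ.filter fun i : Fin m =>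
              decide (0 ≤ sgn (ω j) * (q ω - q (Function.update ω j (!ω j)))) ≠
              decide (0 ≤ sgn (Function.update ω i (!ω i) j) *
                (q (Function.update ω i (!ω i)) -
                  q (Function.update (Function.update ω i (!ω i)) j
                    (!(Function.update ω i (!ω i) j)))))).card : ℝ)))
    (m d : ℕ) (q : (Fin m → Bool) → ℝ) (hq : fourierDegree q ≤ d) :
    ∑ ω : Fin m → Bool, ((Finset.univ.filter fun i : Fin m =>
        decide (0 ≤ q ω) ≠ decide (0 ≤ q (Function.update ω i (!ω i)))).card : ℝ)
      ≤ 2 * (m : ℝ) ^ ((1 : ℝ) - 1 / 2 ^ d) * (2 : ℝ) ^ m := by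
  rcases Nat.eq_zero_or_pos m with rfl | hm
  · -- no coordinates: every function on `Fin 0 → Bool` is constant
    rw [sum_card_pivotal_eq_zero (fun ω ω' => congrArg q (Subsingleton.elim ω ω'))]
    positivity
  have hM : (1 : ℝ) ≤ m := by exact_mod_cast hm
  induction d generalizing q with
  | zero =>
    -- degree `0`: `q` is constant, no bit is pivotal
    have hconst : ∀ ω ω', q ω = q ω' := fun ω ω' => by
      by_contra hne
      have h1 := one_le_fourierDegree hne
      omega
    rw [sum_card_pivotal_eq_zero hconst]
    positivity
  | succ d ih =>
    -- degree `d + 1`: every derivative `D_j q` has degree `≤ d`; sum the induction hypothesis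
    -- over `j` and close with the recursion `hRec`
    refine arith hM ?_ (hRec m q) ?_
    · exact Finset.sum_nonneg fun _ _ => Nat.cast_nonneg _
    · exact Finset.sum_le_sum fun j _ => ih _ (fourierDegree_deriv_le hq j)

end Summit.QuantumAdvantage.QuantumAdvantage.Theorems.LiouvilleOrthogonalTC0

end
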